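import Literature.NumberTheory.EllipticCurves.CyclotomicZpExtensionLocalGeneratorProofs
import Literature.NumberTheory.EllipticCurves.SubgroupSelmer
import HarnessLib

/-!
# Route `ByReductionTypeAtTwo`, crux `MultUpperHalfAtTwo` (item stmt-BirchSwinnertonDyer-19922), TOWER road, the
# «ONE BIT AT A NON-SPLIT 2» rows: KERNEL BRICK 8 — the LOCAL layers of the cyclotomic `ℤ_p`-tower at `v ∣ p` have
# index exactly `p^n` in `Γ_{ℚ_v}` (total ramification), consecutive relative index `p`

HONEST FRAMING (cell `bsd-2adic`, run/shared/lean/pub/bsd-2adic/, seat `bsd-2adic-tower-1` GEN 8, HUMAN RULINGS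
D-0036 / D-0054 / D-0074): TOOL theorems only (no definition, no named fact, no `sorry`); closes nothing by itself;
nothing booked; BSD is not proved by any of this. First brick of module M5 («the local tower at 2») of the KERNELISATION
of the displayed MEMO binder `MultTowerNS2.localTowerKerTwoTorsion_le_two_nonsplitTwo_of_tateUnit` (scope
HOME/tower/SCOPE-hNS2one-kernel-GEN8.md): the local layer subgroups
`H_n = localSubgroup (κ.layerSubgroup n) ℚ_v = res_v⁻¹(κ⁻¹(pⁿ ℤ_p)) ≤ Γ_{ℚ_v}` (the groups in which the local tower kernels
`WeierstrassCurve.localTowerKer κ ℚ_v n` live) have index `p^n` — i.e. `[(ℚ_n)_w : ℚ_v] = p^n = [ℚ_n : ℚ]`, `p` is TOTALLY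
RAMIFIED in the cyclotomic `ℤ_p`-extension — and `[H_n : H_{n+1}] = p` (for `p = 2`: the local layers
`ℚ_{2,n} = ℚ₂(ζ_{2^{n+2}} + ζ⁻¹)` are successive QUADRATIC extensions, the shape used in the scope's steps S5/S6).
Input: the tree theorem `ZpExtension.IsCyclotomic.exists_apply_resGalOfEmb_adicCompletion_eq` («`κ ∘ res_v` is onto»,
`CyclotomicZpExtensionLocalGeneratorProofs.lean`) and `ZpExtension.index_toSubgroup_span_pow`.

* `surjective_kappa_comp_resGal` — `κ ∘ resGal ℚ_v : Γ_{ℚ_v} → ℤ_p` is surjective (`v ∣ p`, `κ` cyclotomic);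
* `index_localSubgroup_layerSubgroup` — `[Γ_{ℚ_v} : H_n] = p^n`;
* `relIndex_localSubgroup_layerSubgroup_succ` — `[H_n : H_{n+1}] = p`;
* `exists_mem_absInertia_mem_localSubgroup_kerSubgroup` — every `σ ∈ Γ_{ℚ_v}` is `τ · h` with `τ` in the local INERTIA
  group and `h ∈ H_∞ = localSubgroup κ.kerSubgroup ℚ_v` (`Γ_{ℚ_v} = I · H_∞`; used in M6/S1–S2 to pick INERTIAL
  topological generators of `H_n/H_∞` and an element of `H_∞` flipping `√γ`).

References: L. Washington, *Introduction to Cyclotomic Fields*, §13.1, Prop. 13.2; R. Greenberg, LNM 1716 §1, §3 p. 86;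
scope memo SCOPE-hNS2one-kernel-GEN8.md M5.
-/

set_option autoImplicit false
-- the Theorems namespace of this sub repeats the summit name by design (D-0017 nested layout: Summit.<S>.<Sub>)
set_option linter.dupNamespace false

noncomputable section

namespace Summit.BirchSwinnertonDyer.BirchSwinnertonDyer.Theorems.MultTowerNS2

open NumberField IsDedekindDomain Field Literature.NumberTheory.EllipticCurves
  Literature.NumberTheory.GaloisRepresentations

variable {p : ℕ} [Fact p.Prime] {κ : ZpExtension ℚ p}

/-- **`κ ∘ res_v : Γ_{ℚ_v} → ℤ_p` is surjective** for the cyclotomic `ℤ_p`-extension and `v ∣ p` (`resGal ℚ_v` is the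
tree's chosen restriction `resGalOfEmb (closureEmb ℚ_v)`). [cite: Washington1997, §13.1] -/
theorem surjective_kappa_comp_resGal (hκ : κ.IsCyclotomic) (v : HeightOneSpectrum (𝓞 ℚ))
    (hv : (p : 𝓞 ℚ) ∈ v.asIdeal) :
    Function.Surjective (κ.toContinuousMonoidHom.toMonoidHom.comp
      (resGal (K := ℚ) (v.adicCompletion ℚ)).toMonoidHom) := by
  intro t
  obtain ⟨g, hg⟩ := hκ.exists_apply_resGalOfEmb_adicCompletion_eq v hv t
  exact ⟨g, hg⟩

/-- The local layer subgroup is the preimage of `pⁿ ℤ_p` under `κ ∘ res_v`. [folklore] -/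
theorem localSubgroup_layerSubgroup_eq_comap (v : HeightOneSpectrum (𝓞 ℚ)) (n : ℕ) :
    localSubgroup (κ.layerSubgroup n) (v.adicCompletion ℚ) =
      (AddSubgroup.toSubgroup (Ideal.span {(p : ℤ_[p]) ^ n}).toAddSubgroup).comap
        (κ.toContinuousMonoidHom.toMonoidHom.comp (resGal (K := ℚ) (v.adicCompletion ℚ)).toMonoidHom) := by
  ext τ
  rw [mem_localSubgroup_iff, Subgroup.mem_comap]
  rfl

/-- **`[Γ_{ℚ_v} : H_n] = p^n`**: the local layer subgroup `H_n = res_v⁻¹(κ⁻¹(pⁿℤ_p))` of the cyclotomic `ℤ_p`-tower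
at `v ∣ p` has index `p^n` — the local degree `[(ℚ_n)_w : ℚ_v]` equals the global degree `[ℚ_n : ℚ] = p^n` (`p`
totally ramified in `ℚ_∞/ℚ`). [cite: Washington1997, §13.1] -/
theorem index_localSubgroup_layerSubgroup (hκ : κ.IsCyclotomic) (v : HeightOneSpectrum (𝓞 ℚ))
    (hv : (p : 𝓞 ℚ) ∈ v.asIdeal) (n : ℕ) :
    (localSubgroup (κ.layerSubgroup n) (v.adicCompletion ℚ)).index = p ^ n := by
  rw [localSubgroup_layerSubgroup_eq_comap v n,
    Subgroup.index_comap_of_surjective _ (surjective_kappa_comp_resGal hκ v hv),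
    ZpExtension.index_toSubgroup_span_pow]

/-- `H_{n+1} ≤ H_n` for the local layer subgroups. [folklore] -/
theorem localSubgroup_layerSubgroup_succ_le (v : HeightOneSpectrum (𝓞 ℚ)) (n : ℕ) :
    localSubgroup (κ.layerSubgroup (n + 1)) (v.adicCompletion ℚ) ≤
      localSubgroup (κ.layerSubgroup n) (v.adicCompletion ℚ) :=
  Subgroup.comap_mono (κ.layerSubgroup_antitone (Nat.le_succ n))

/-- **`[H_n : H_{n+1}] = p`**: consecutive local layers of the cyclotomic `ℤ_p`-tower at `v ∣ p` have relative index `p`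
(for `p = 2`: the local layers are successive quadratic extensions). [cite: Washington1997, §13.1] -/
theorem relIndex_localSubgroup_layerSubgroup_succ (hκ : κ.IsCyclotomic) (v : HeightOneSpectrum (𝓞 ℚ))
    (hv : (p : 𝓞 ℚ) ∈ v.asIdeal) (n : ℕ) :
    (localSubgroup (κ.layerSubgroup (n + 1)) (v.adicCompletion ℚ)).relIndex
      (localSubgroup (κ.layerSubgroup n) (v.adicCompletion ℚ)) = p := by
  have h := Subgroup.relIndex_mul_index (localSubgroup_layerSubgroup_succ_le (κ := κ) v n)
  rw [index_localSubgroup_layerSubgroup hκ v hv, index_localSubgroup_layerSubgroup hκ v hv, pow_succ,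
    mul_comm] at h
  exact mul_right_cancel₀ (pow_ne_zero n (Fact.out : p.Prime).ne_zero) (by linarith [h])

/-- **`Γ_{ℚ_v} = I · H_∞`-type decomposition, layer form**: for every `σ ∈ Γ_{ℚ_v}` there is `τ` in the INERTIA group
`absInertia ℚ_v` with `κ(res τ) = κ(res σ)`, hence `τ⁻¹ σ ∈ H_∞ = localSubgroup κ.kerSubgroup ℚ_v` — every local layer
subgroup is generated by `H_∞` and inertial elements. [cite: Washington1997, §13.1] -/
theorem exists_mem_absInertia_mem_localSubgroup_kerSubgroup (hκ : κ.IsCyclotomic) (v : HeightOneSpectrum (𝓞 ℚ))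
    (hv : (p : 𝓞 ℚ) ∈ v.asIdeal) (σ : absoluteGaloisGroup (v.adicCompletion ℚ)) :
    ∃ τ : absoluteGaloisGroup (v.adicCompletion ℚ), τ ∈ absInertia (v.adicCompletion ℚ) ∧
      τ⁻¹ * σ ∈ localSubgroup κ.kerSubgroup (v.adicCompletion ℚ) := by
  obtain ⟨τ, hτI, hτ⟩ := hκ.exists_mem_absInertia_apply_resGalOfEmb_adicCompletion_eq v hv
    (κ (resGal (K := ℚ) (v.adicCompletion ℚ) σ))
  refine ⟨τ, hτI, ?_⟩
  rw [mem_localSubgroup_iff, ZpExtension.mem_kerSubgroup, map_mul, map_inv, map_mul, map_inv]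
  change (κ (resGalOfEmb (closureEmb (K := ℚ) (v.adicCompletion ℚ)) τ))⁻¹ * _ = 1
  rw [hτ, inv_mul_cancel]

end Summit.BirchSwinnertonDyer.BirchSwinnertonDyer.Theorems.MultTowerNS2

end
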